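import Literature.AlgebraicGeometry.CossartJannsenSaito2020.KeyTheoremsAPI
import Literature.AlgebraicGeometry.CossartJannsenSaito2020.ProjDirProjectiveLine
import Literature.AlgebraicGeometry.Resolution.BlowupChartMembership
import Literature.AlgebraicGeometry.Resolution.HypersurfaceTransformChart
import Literature.AlgebraicGeometry.Resolution.PermissibleCentres
import Literature.RingTheory.HilbertSamuel.ProjDirectrixLiftsTransport
import Literature.RingTheory.HilbertSamuel.ProjDirectrixGenerators
import HarnessLib

/-!
# CJS LNM 2270, p. 103 / Def. 6.34 (i): `C_1 = ℙ(Dir_x(X)) ⊂ X_1 = Bℓ_x(X)` is CLOSED — PROOF, for every `t = e_x(X)`,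
# with the chart description of `ℙ(Dir_x(X))` on the blow-up charts at the generators of `𝔭_x`

Source: V. Cossart, U. Jannsen, S. Saito, *Desingularization: Invariants and Strategy*, LNM **2270** (2020)
[`CossartJannsenSaito2020`], p. 103 L15 «`C_1 := ℙ(Dir^O_x(X)) ⊂ ℙ(Dir_x(X)) ⊂ X_1`», Def. 6.34 (i) (p. 104). The tree
renders `ℙ(Dir_x(X)) ⊂ π⁻¹(x)` as the POINT SET `projDirectrixFibre π x` of `X'` (`KeyTheorems.lean`: the points `ξ` over
`x` at which every linear form of the directrix space `𝒯 ⊆ 𝔪_x/𝔪_x²` vanishes, `IsOnProjDirectrix π ξ`). This file PROVES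
that this set is closed in `X'` (`isClosed_projDirectrixFibre`) — the content of the named fact `ProjDir_isClosed` of
`ProjDirProjectiveLine.lean`, and the hypothesis `IsClosed (T.projDir x)` of `IsFundamentalSequence.localize`
(`BlowupTowerLocalizePerm.lean`) — via an explicit description on charts which the `t = 2` structure theorem
(`ℙ(Dir) ≅ ℙ^1`) reuses:

1. Choose an affine open `U ∋ x`, so `𝓘_{{x}}(U) = 𝔭 = 𝔭_x` is a maximal ideal of `R = Γ(X, U)`, `𝒪_{X,x} = R_𝔭`, and fix
   generators `c_1, …, c_r` of `𝔭` with expansions `c_l = Σ_i a_{li} x_i` in the tree's minimal generators `x_i` of `𝔪_x`.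
   The charts `g_j : Spec R[𝔭/c_j] → X'` (`j = 1, …, r`) are open immersions covering `π⁻¹(U)`: at a point `ξ'` over `U`
   the exceptional ideal `𝔭𝒪_{ξ'}` is invertible, generated by the `c_l`, hence by ONE `c_j`
   (`exists_span_singleton_eq_of_span_range_eq`, a local-ring lemma), and then `ξ'` lies on `g_j`
   (`IsBlowup.mem_range_chart_of_stalkIdeal_eq_span`).
2. **Chart description** (`mem_projDirectrixFibre_chart_iff`, stated for an abstract chart ring `D` generated by the
   ratios `e_l = c_l/c_j`): a point `w` of the chart lies on `ℙ(Dir_x(X))` iff its prime CONTAINS the ideal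
   `𝔑_j = 𝔭·D + (Σ_l λ_l e_l : λ ∈ R^r, symbol of Σ_l λ_l c_l in 𝒯)`. Indeed `π^♯(Σ λ_l c_l) = c_j · Σ λ_l e_l`
   with `c_j` a nonzerodivisor generating the exceptional ideal, so «`π^♯(ℓ) ∈ (𝔪_x 𝒪_ξ)·𝔪_ξ` for the lifts `ℓ` of the
   directrix forms» (`IsOnProjDirectrix`, read on `𝒪_{X,x}` by `isOnProjDirectrix_iff_projDirLiftsInto` and on combinations
   of the `c_l` by `ProjDirectrixGenerators.lean`) says exactly `Σ λ_l e_l ∈ 𝔪_w`; for the converse the coefficient vectors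
   `μ ∈ k(x)^r` are lifted to SECTIONS (`x` closed ⇒ `R → k(x)` onto).
3. Hence `ℙ(Dir) ∩ g_j(Spec D_j) = g_j(V(𝔑_j))` is closed in the chart; as `ℙ(Dir) ⊆ π⁻¹(x)` is covered by the charts and
   the `g_j` are open embeddings, `ℙ(Dir)` is closed (`isClosed_projDirectrixFibre`).

Boundary-free, as the statement. NOT a statement of H. Hironaka's manuscript; a PROOF about a typed published notion
of [CJS 2020] for the L-lane of cell res-hironaka ([L W4.2], res-L1-w42-plan-1 RULINGS v3.12-3 (O), deal P-a).
AI-written; weaker than expert review.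

## References

* V. Cossart, U. Jannsen, S. Saito, LNM 2270 (2020), Def. 2.18, Def. 6.34 (i) (p. 104), p. 103. [CossartJannsenSaito2020]
* The Stacks Project, Tag 0804 (charts of a blowing up). [StacksProject]
-/

noncomputable section

open CategoryTheory AlgebraicGeometry TopologicalSpace IsLocalRing
open Literature.AlgebraicGeometry.Resolution Literature.RingTheory.HilbertSamuel Literature.RingTheory.MvPolynomial

namespace Literature.AlgebraicGeometry.CossartJannsenSaito2020

universe u

/-! ## Plumbing: charts of a blow-up at a generating family; stalks on a chart -/

/-- The chart `g_j : Spec (R[It])_{(c_j t)} → X'` of a blowing up `π` along `C` over an affine open `U`, for a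
generating family `c` of `I = C(U)` (so that the chart ring is literally `chartRing c j`): an open immersion over
`Spec R → X` through `chartBase c j`, containing every point at which `c_j` generates the exceptional ideal
(`IsBlowup.exists_charts`, `IsBlowup.mem_range_chart_of_stalkIdeal_eq_span`). [cite: StacksProject, Tag 0804] -/
private theorem exists_chart_of_ideal_eq_span' {X' X : Scheme.{u}} {π : X' ⟶ X} {C : X.IdealSheafData}
    (hπ : IsBlowup π C) (U : X.affineOpens) {r : ℕ} (c : Fin r → Γ(X, U))
    (hc : C.ideal U = Ideal.span (Set.range c)) (j : Fin r) :
    ∃ g : Spec (.of (chartRing c j)) ⟶ X', IsOpenImmersion g ∧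
      g ≫ π = Spec.map (CommRingCat.ofHom (chartBase c j)) ≫ U.2.fromSpec ∧
      ∀ (x' : X') (hx : π x' ∈ (U : X.Opens)),
        stalkIdeal (C.comap π) x' =
            Ideal.span {(π.stalkMap x').hom ((X.presheaf.germ U (π x') hx).hom (c j))} →
          x' ∈ Set.range g := by
  have key : ∀ (I : Ideal Γ(X, U)) (_ : C.ideal U = I) (b : Γ(X, U)) (hb : b ∈ I),
      ∃ g : Spec (.of (HomogeneousLocalization.Away (reesGrading I) (reesT b hb))) ⟶ X',
        IsOpenImmersion g ∧
        g ≫ π = Spec.map (CommRingCat.ofHom (reesChartBase b hb)) ≫ U.2.fromSpec ∧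
        ∀ (x' : X') (hx : π x' ∈ (U : X.Opens)),
          stalkIdeal (C.comap π) x' =
              Ideal.span {(π.stalkMap x').hom ((X.presheaf.germ U (π x') hx).hom b)} →
            x' ∈ Set.range g := by
    rintro I rfl b hb
    obtain ⟨g, h1, h2, -⟩ := hπ.exists_charts U
    exact ⟨g b hb, h1 b hb, h2 b hb, fun x' hx hgen =>
      hπ.mem_range_chart_of_stalkIdeal_eq_span U hb (g b hb) (h2 b hb) hx hgen⟩
  exact key _ hc (c j) (Ideal.mem_span_range_self (f := c) (x := j))

/-- On a chart `g : Spec D → X'` with `g ≫ π = Spec f ≫ (Spec Γ(X, U) → X)`: `g^♯_w ∘ π^♯_{g w} ∘ germ = (D → 𝒪_{Spec D, w}) ∘ f`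
(germs of `appLE_chart_eq`). [cite: StacksProject, Tag 0804] -/
private theorem stalkMap_stalkMap_germ_of_chart' {X' X : Scheme.{u}} (π : X' ⟶ X) (U : X.affineOpens)
    {D : CommRingCat.{u}} (g : Spec D ⟶ X') (f : Γ(X, U) ⟶ D)
    (hg : g ≫ π = Spec.map f ≫ U.2.fromSpec) (w : Spec D) (hx : π (g w) ∈ (U : X.Opens)) (r : Γ(X, U)) :
    (g.stalkMap w).hom ((π.stalkMap (g w)).hom ((X.presheaf.germ U (π (g w)) hx).hom r)) =
      ((Spec D).presheaf.germ ⊤ w trivial).hom ((Scheme.ΓSpecIso D).inv.hom (f.hom r)) := by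
  have e := top_le_preimage_of_chart U g f hg
  have h1 : ((Spec D).presheaf.germ ⊤ w trivial).hom ((g ≫ π).appLE U ⊤ e r) =
      ((g ≫ π).stalkMap w).hom ((X.presheaf.germ U ((g ≫ π) w) (e trivial)).hom r) := by
    change ((g ≫ π).appLE U ⊤ e ≫ (Spec D).presheaf.germ ⊤ w trivial).hom r =
      (X.presheaf.germ U ((g ≫ π) w) (e trivial) ≫ (g ≫ π).stalkMap w).hom r
    rw [Scheme.Hom.germ_stalkMap, Scheme.Hom.appLE, Category.assoc, (Spec D).presheaf.germ_res]
  rw [appLE_chart_eq U g f hg e, Scheme.Hom.stalkMap_comp] at h1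
  exact h1.symm

/-- **`IsOnProjDirectrix` read on `𝒪_{X,x}`** for a point `ξ` with `π ξ = x`: composing `π^♯_ξ` with the identification
`𝒪_{X,x} ≅ 𝒪_{X,π ξ}` of stalks at equal points, the condition is EQUIVALENT to `ProjDirLiftsInto` for the fixed minimal
generators of `𝒪_{X,x}` (independence of the minimal system and transport along ring isomorphisms,
`ProjDirectrixLifts(Transport).lean`). [cite: CossartJannsenSaito2020, Def. 2.18, Def. 6.34 (i)] -/
theorem isOnProjDirectrix_iff_projDirLiftsInto {X₁ X : Scheme.{u}} [IsLocallyNoetherian X] (π : X₁ ⟶ X)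
    {x : X} {ξ : X₁} (h : π.base ξ = x) :
    IsOnProjDirectrix π ξ ↔
      ProjDirLiftsInto ((π.stalkMap ξ).hom.comp (X.presheaf.stalkCongr (.of_eq h.symm)).hom.hom)
        (minGenerators (X.presheaf.stalk x)) (span_range_minGenerators _) := by
  set A := X.presheaf.stalk x with hA
  set A' := X.presheaf.stalk (π.base ξ) with hA'
  let αiso : A ≅ A' := X.presheaf.stalkCongr (.of_eq h.symm)
  let α : A ≃+* A' := αiso.commRingCatIsoToRingEquiv
  let β : ↑(X₁.presheaf.stalk ξ) ≃+* ↑(X₁.presheaf.stalk ξ) := RingEquiv.refl _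
  have hcomm : ∀ a, (π.stalkMap ξ).hom (α a) = β (((π.stalkMap ξ).hom.comp αiso.hom.hom) a) := fun _ => rfl
  have he : (maximalIdeal A').spanFinrank = (maximalIdeal A).spanFinrank :=
    spanFinrank_maximalIdeal_eq_of_ringEquiv α
  haveI : IsLocalHom (π.stalkMap ξ).hom := π.toLRSHom.prop ξ
  have hgen : Ideal.span (Set.range (α ∘ minGenerators A)) = maximalIdeal A' :=
    span_range_ringEquiv_comp α (span_range_minGenerators A)
  have hsurj : Function.Surjective (Fin.cast he) := fun i => ⟨Fin.cast he.symm i, by simp⟩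
  have hgen' : Ideal.span (Set.range ((α ∘ minGenerators A) ∘ Fin.cast he)) = maximalIdeal A' := by
    rw [hsurj.range_comp]
    exact hgen
  have h1 : IsOnProjDirectrix π ξ ↔ ProjDirLiftsInto (π.stalkMap ξ).hom ((α ∘ minGenerators A) ∘ Fin.cast he) hgen' :=
    projDirLiftsInto_iff_of_minimal_of_isLocalHom _ (span_range_minGenerators A') hgen' rfl
  have h2 : ProjDirLiftsInto (π.stalkMap ξ).hom ((α ∘ minGenerators A) ∘ Fin.cast he) hgen' ↔
      ProjDirLiftsInto (π.stalkMap ξ).hom (α ∘ minGenerators A) hgen :=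
    projDirLiftsInto_comp_cast_iff _ he hgen hgen'
  have h3 : ProjDirLiftsInto (π.stalkMap ξ).hom (α ∘ minGenerators A) hgen ↔
      ProjDirLiftsInto ((π.stalkMap ξ).hom.comp αiso.hom.hom) (minGenerators A) (span_range_minGenerators A) :=
    projDirLiftsInto_ringEquiv_iff α β hcomm (span_range_minGenerators A)
  exact h1.trans (h2.trans h3)

/-! ## A local-ring lemma: an invertible ideal generated by a family is generated by one member -/

/-- **In a local ring, if `(u_1, …, u_r) = (t)` with `t` a nonzerodivisor, then `(u_j) = (t)` for some `j`.** Writing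
`u_l = t b_l` and `t = Σ a_l u_l = t Σ a_l b_l` gives `Σ a_l b_l = 1`, so some `b_j` is a unit. (At a point of a blow-up:
the exceptional ideal, generated by the generators of the centre's ideal, is generated by one of them.) [folklore] -/
private theorem exists_span_singleton_eq_of_span_range_eq {B : Type u} [CommRing B] [IsLocalRing B] {r : ℕ}
    (u : Fin r → B) {t : B} (ht : t ∈ nonZeroDivisors B) (h : Ideal.span (Set.range u) = Ideal.span {t}) :
    ∃ j, Ideal.span {u j} = Ideal.span {t} := by
  classical
  have hb : ∀ l, ∃ b : B, b * t = u l := fun l =>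
    Ideal.mem_span_singleton'.mp (h ▸ Ideal.subset_span ⟨l, rfl⟩)
  choose b hb using hb
  obtain ⟨a, ha⟩ : ∃ a : Fin r → B, ∑ l, a l * u l = t :=
    Ideal.mem_span_range_iff_exists_fun.mp (h.symm ▸ Ideal.mem_span_singleton_self t)
  have hsum : ∑ l, a l * b l = 1 := by
    have h1 : (∑ l, a l * b l - 1) * t = 0 := by
      rw [sub_mul, one_mul, Finset.sum_mul, sub_eq_zero]
      conv_rhs => rw [← ha]
      exact Finset.sum_congr rfl fun l _ => by rw [mul_assoc, hb l]
    exact sub_eq_zero.mp ((mem_nonZeroDivisors_iff_right.mp ht) _ h1)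
  -- some summand is a unit
  have hex : ∃ j, IsUnit (a j * b j) := by
    by_contra hall
    simp only [not_exists] at hall
    have hmem : ∑ l, a l * b l ∈ maximalIdeal B :=
      Ideal.sum_mem _ fun l _ => (mem_maximalIdeal _).mpr (mem_nonunits_iff.mpr (hall l))
    rw [hsum] at hmem
    exact (mem_maximalIdeal _).mp hmem isUnit_one
  obtain ⟨j, hj⟩ := hex
  refine ⟨j, ?_⟩
  have hbj : IsUnit (b j) := isUnit_of_mul_isUnit_right hj
  rw [← hb j, Ideal.span_singleton_mul_left_unit hbj]

/-! ## The chart description of `ℙ(Dir_x(X))` -/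

section Chart

variable {X' X : Scheme.{u}} [IsLocallyNoetherian X] (π : X' ⟶ X) (U : X.affineOpens) {x : X}
  (hxU : x ∈ (U : X.Opens))
  {D : CommRingCat.{u}} (ψ : Γ(X, U) ⟶ D) {r : ℕ} (c : Fin r → Γ(X, U)) (j : Fin r) (e : Fin r → D)
  (a : Fin r → Fin (maximalIdeal (X.presheaf.stalk x)).spanFinrank → X.presheaf.stalk x)

variable (g : Spec D ⟶ X') [IsOpenImmersion g] (hgπ : g ≫ π = Spec.map ψ ≫ U.2.fromSpec)
  (hce : ∀ k, ψ.hom (c k) = ψ.hom (c j) * e k) (hcj : ψ.hom (c j) ∈ nonZeroDivisors D)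
  (hx : IsClosed ({x} : Set X))
  (hc : Ideal.span (Set.range c) = (U.2.primeIdealOf ⟨x, hxU⟩).asIdeal)
  (ha : ∀ l, ∑ i, a l i * minGenerators (X.presheaf.stalk x) i = (X.presheaf.germ U x hxU).hom (c l))

include hgπ hce hcj hx hc ha in
/-- **Chart description of `ℙ(Dir_x(X))`.** On the chart `g : Spec D → X'` of the blow-up `π` of `X` in the closed point
`x` (`D = Γ(U)[𝔭_x/c_j]` generated by the ratios `e_l` with `ψ(c_l) = ψ(c_j) e_l`, `ψ(c_j)` a nonzerodivisor), a point `w`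
maps into `ℙ(Dir_x(X)) = projDirectrixFibre π x` iff its prime ideal contains the ideal
`𝔑_j = 𝔭_x·D + (Σ_l λ_l e_l : λ ∈ R^r, symbol Σ_i (Σ_l λ̄_l ā_{li}) X_i of Σ_l λ_l c_l in 𝒯)` — `𝔭_x·D` and the ratios
`Σ_l λ_l e_l` of the combinations `Σ_l λ_l c_l` whose symbol is a directrix form; here `c_l = Σ_i a_{li} x_i` are chosen
expansions of the germs in the fixed minimal generators `x_i` of `𝔪_x` (`minGenerators`) and `𝒯 = 𝒯(J)` is the directrix
space of the tangent cone ideal (`canonicalTangentConeIdeal`). (→): `π^♯(Σ λ_l c_l) = c_j·(Σ λ_l e_l)`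
lies in `(c_j)·𝔪` (`ProjDirLiftsInto.map_sum_mul_mem`) and `c_j` is a nonzerodivisor. (←): every `μ ∈ k(x)^r` lifts to
sections (`x` closed), so `projDirLiftsInto_of_forall_symbol_mem` applies. [cite: CossartJannsenSaito2020, Def. 6.34 (i), Def. 2.18] -/
theorem mem_projDirectrixFibre_chart_iff (w : Spec D) :
    g w ∈ projDirectrixFibre π x ↔
      ((U.2.primeIdealOf ⟨x, hxU⟩).asIdeal.map ψ.hom ⊔
        Ideal.span {d : D | ∃ lam : Fin r → Γ(X, U),
          (linForm fun i => ∑ l, residue (X.presheaf.stalk x) ((X.presheaf.germ U x hxU).hom (lam l)) *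
              residue (X.presheaf.stalk x) (a l i)) ∈
            directrixSpace (canonicalTangentConeIdeal (X.presheaf.stalk x)) ∧
          d = ∑ l, ψ.hom (lam l) * e l}) ≤ w.asIdeal := by
  classical
  -- (0) notation and the local structure at `x`
  set A := X.presheaf.stalk x with hA
  obtain ⟨𝔭, h𝔭⟩ : ∃ 𝔭 : PrimeSpectrum Γ(X, U), 𝔭 = U.2.primeIdealOf ⟨x, hxU⟩ := ⟨_, rfl⟩
  haveI h𝔭max : 𝔭.asIdeal.IsMaximal := h𝔭 ▸ U.2.primeIdealOf_isMaximal_of_isClosed ⟨x, hxU⟩ hx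
  haveI : IsNoetherianRing Γ(X, U) := IsLocallyNoetherian.component_noetherian U
  letI : Algebra Γ(X, U) A := TopCat.Presheaf.algebra_section_stalk X.presheaf (⟨x, hxU⟩ : (U : X.Opens))
  haveI hloc : IsLocalization.AtPrime A 𝔭.asIdeal := h𝔭 ▸ U.2.isLocalization_stalk ⟨x, hxU⟩
  have halg : ∀ s : Γ(X, U), algebraMap Γ(X, U) A s = (X.presheaf.germ U x hxU).hom s := fun _ => rfl
  rw [← h𝔭] at hc
  have hcm : ∀ l, algebraMap Γ(X, U) A (c l) ∈ maximalIdeal A :=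
    fun l => (IsLocalization.AtPrime.to_map_mem_maximal_iff A 𝔭.asIdeal (c l)).mpr
      (hc ▸ Ideal.subset_span ⟨l, rfl⟩)
  have hspanA : Ideal.span (Set.range fun l => algebraMap Γ(X, U) A (c l)) = maximalIdeal A := by
    have h := IsLocalization.AtPrime.map_eq_maximalIdeal 𝔭.asIdeal A
    rwa [← hc, Ideal.map_span, ← Set.range_comp] at h
  have ha' : ∀ l, algebraMap Γ(X, U) A (c l) = ∑ i, a l i * minGenerators A i := fun l => (ha l).symm
  -- residues of sections exhaust `k(x)` (`𝔭` is maximal)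
  have hressurj : ∀ q : ResidueField A, ∃ ρ : Γ(X, U), residue A (algebraMap Γ(X, U) A ρ) = q := by
    intro q
    obtain ⟨a₀, rfl⟩ := Ideal.Quotient.mk_surjective q
    obtain ⟨⟨ρ, s⟩, hρs⟩ := IsLocalization.surj 𝔭.asIdeal.primeCompl a₀
    obtain ⟨y, i, hi, hyi⟩ := h𝔭max.exists_inv s.2
    refine ⟨y * ρ, ?_⟩
    change residue A _ = residue A a₀
    rw [← sub_eq_zero, ← map_sub, residue_eq_zero_iff]
    have h1 : algebraMap Γ(X, U) A (y * ρ) - a₀ =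
        -(algebraMap Γ(X, U) A i * a₀) + (algebraMap Γ(X, U) A y * algebraMap Γ(X, U) A s + algebraMap Γ(X, U) A i - 1) * a₀ := by
      have : a₀ * algebraMap Γ(X, U) A s = algebraMap Γ(X, U) A ρ := hρs
      rw [map_mul]
      linear_combination (-(algebraMap Γ(X, U) A y)) * this
    have h2 : algebraMap Γ(X, U) A y * algebraMap Γ(X, U) A s + algebraMap Γ(X, U) A i - 1 = 0 := by
      rw [← map_mul, ← map_add, hyi, map_one, sub_self]
    rw [h1, h2, zero_mul, add_zero]
    exact Submodule.neg_mem _ (Ideal.mul_mem_right _ _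
      ((IsLocalization.AtPrime.to_map_mem_maximal_iff A 𝔭.asIdeal i).mpr hi))
  -- (1) `w` over `𝔭` ⟺ `π (g w) = x`
  have hover : π.base (g w) = x ↔ w.asIdeal.comap ψ.hom = 𝔭.asIdeal := by
    have e1 : (g ≫ π) w = U.2.fromSpec (PrimeSpectrum.comap ψ.hom w) := by
      rw [hgπ, Scheme.Hom.comp_apply, Spec.map_apply]
    constructor
    · intro hwx
      have h1 : (g ≫ π) w = x := by rw [Scheme.Hom.comp_apply]; exact hwx
      rw [e1] at h1
      have h2 : PrimeSpectrum.comap ψ.hom w ∈ U.2.fromSpec ⁻¹' {x} := h1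
      rw [fromSpec_preimage_singleton U.2 hxU] at h2
      exact congrArg PrimeSpectrum.asIdeal ((Set.mem_singleton_iff.mp h2).trans h𝔭.symm)
    · intro hw
      have h2 : PrimeSpectrum.comap ψ.hom w = 𝔭 := PrimeSpectrum.ext hw
      have h3 : (g ≫ π) w = x := by
        rw [e1, h2, h𝔭, IsAffineOpen.fromSpec_primeIdealOf]
      rwa [Scheme.Hom.comp_apply] at h3
  constructor
  · -- (→)
    intro hmem
    obtain ⟨hwx, hP⟩ := (mem_projDirectrixFibre π x _).mp hmem
    have hw𝔭 : w.asIdeal.comap ψ.hom = 𝔭.asIdeal := hover.mp hwx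
    have hwU : π.base (g w) ∈ (U : X.Opens) := hwx ▸ hxU
    -- `φ : 𝒪_{X,x} → 𝒪_{X', g w}`
    let ι : A ≅ X.presheaf.stalk (π.base (g w)) := X.presheaf.stalkCongr (.of_eq hwx.symm)
    haveI : IsLocalHom (π.stalkMap (g w)).hom := π.toLRSHom.prop (g w)
    let φ : A →+* X'.presheaf.stalk (g w) := (π.stalkMap (g w)).hom.comp ι.hom.hom
    have hφgerm : ∀ s : Γ(X, U), φ (algebraMap Γ(X, U) A s) =
        (π.stalkMap (g w)).hom ((X.presheaf.germ U (π.base (g w)) hwU).hom s) := by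
      intro s
      rw [halg, RingHom.comp_apply]
      change (π.stalkMap (g w)).hom ((X.presheaf.germ U x hxU ≫ ι.hom).hom s) = _
      rw [TopCat.Presheaf.stalkCongr_hom, TopCat.Presheaf.germ_stalkSpecializes]
    have hPφ : ProjDirLiftsInto φ (minGenerators A) (span_range_minGenerators A) :=
      (isOnProjDirectrix_iff_projDirLiftsInto π hwx).mp hP
    -- the local dictionary on the chart
    let σ : ↑(X'.presheaf.stalk (g w)) ≃+* ↑((Spec D).presheaf.stalk w) :=
      (asIso (g.stalkMap w)).commRingCatIsoToRingEquiv
    have hσ : ∀ b, σ b = (g.stalkMap w).hom b := fun _ => rfl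
    let τ : D ⟶ (Spec D).presheaf.stalk w := (Scheme.ΓSpecIso D).inv ≫ (Spec D).presheaf.germ ⊤ w trivial
    letI : Algebra D ((Spec D).presheaf.stalk w) := τ.hom.toAlgebra
    haveI hlocL : IsLocalization.AtPrime ((Spec D).presheaf.stalk w) w.asIdeal :=
      StructureSheaf.IsLocalization.to_stalk (R := D) w
    have hστ : ∀ s : Γ(X, U), σ (φ (algebraMap Γ(X, U) A s)) = τ.hom (ψ.hom s) := by
      intro s
      rw [hφgerm, hσ]
      exact stalkMap_stalkMap_germ_of_chart' π U g ψ hgπ w hwU s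
    have hσm : ∀ b, b ∈ maximalIdeal (X'.presheaf.stalk (g w)) ↔ σ b ∈ maximalIdeal ((Spec D).presheaf.stalk w) := by
      intro b
      rw [mem_maximalIdeal, mem_maximalIdeal, mem_nonunits_iff, mem_nonunits_iff, MulEquiv.isUnit_map σ]
    have hτw : ∀ d : D, d ∈ w.asIdeal ↔ τ.hom d ∈ maximalIdeal ((Spec D).presheaf.stalk w) :=
      fun d => (IsLocalization.AtPrime.to_map_mem_maximal_iff ((Spec D).presheaf.stalk w) w.asIdeal d).symm
    have hreg : τ.hom (ψ.hom (c j)) ∈ nonZeroDivisors ((Spec D).presheaf.stalk w) :=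
      map_mem_nonZeroDivisors_of_isLocalization w.asIdeal.primeCompl ((Spec D).presheaf.stalk w) hcj
    -- `𝔪_x 𝒪_{g w} = (c_j)`
    have hmapφ : (maximalIdeal A).map φ = Ideal.span {φ (algebraMap Γ(X, U) A (c j))} := by
      apply le_antisymm
      · rw [← hspanA, Ideal.map_span, Ideal.span_le]
        rintro _ ⟨_, ⟨l, rfl⟩, rfl⟩
        have h1 : σ (φ (algebraMap Γ(X, U) A (c l))) = σ (φ (algebraMap Γ(X, U) A (c j))) * τ.hom (e l) := by
          rw [hστ, hστ, hce l, map_mul]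
        have h2 : φ (algebraMap Γ(X, U) A (c l)) = φ (algebraMap Γ(X, U) A (c j)) * σ.symm (τ.hom (e l)) := by
          apply σ.injective
          rw [map_mul, σ.apply_symm_apply]
          exact h1
        rw [SetLike.mem_coe, h2]
        exact Ideal.mul_mem_right _ _ (Ideal.mem_span_singleton_self _)
      · rw [Ideal.span_le, Set.singleton_subset_iff]
        exact Ideal.mem_map_of_mem φ (hcm j)
    -- conclusion of (→)
    refine sup_le ?_ ?_
    · rw [Ideal.map_le_iff_le_comap, hw𝔭, h𝔭]
    · rw [Ideal.span_le]
      rintro d ⟨lam, hlam, rfl⟩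
      -- the combination `Σ λ_l c_l` in `A` goes to `(c_j)·𝔪`
      have hsymb : (linForm fun i => ∑ l, residue A (algebraMap Γ(X, U) A (lam l)) * residue A (a l i)) ∈
          directrixSpace (tangentConeIdeal (minGenerators A) (span_range_minGenerators A)) := hlam
      have hkey := ProjDirLiftsInto.map_sum_mul_mem (span_range_minGenerators A) a ha' hPφ
        (fun l => algebraMap Γ(X, U) A (lam l)) hsymb
      rw [hmapφ] at hkey
      obtain ⟨m, hm, hmk⟩ := Ideal.mem_span_singleton_mul.mp hkey
      -- read in `L = 𝒪_{Spec D, w}`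
      have hsum : φ (∑ l, algebraMap Γ(X, U) A (lam l) * algebraMap Γ(X, U) A (c l)) =
          φ (algebraMap Γ(X, U) A (∑ l, lam l * c l)) := by
        rw [map_sum (algebraMap Γ(X, U) A)]
        congr 1
        exact Finset.sum_congr rfl fun l _ => by rw [map_mul]
      have hψsum : ψ.hom (∑ l, lam l * c l) = ψ.hom (c j) * ∑ l, ψ.hom (lam l) * e l := by
        rw [map_sum, Finset.mul_sum]
        refine Finset.sum_congr rfl fun l _ => ?_
        rw [map_mul, hce l]
        ring
      have h := congrArg σ hmk
      rw [map_mul, hsum, hστ, hστ, hψsum, map_mul] at h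
      -- `h : τψc_j * σ m = τψc_j * τ(Σ …)`
      have e1 : (σ m - τ.hom (∑ l, ψ.hom (lam l) * e l)) * τ.hom (ψ.hom (c j)) = 0 := by
        rw [sub_mul, mul_comm, h, mul_comm, sub_self]
      have e2 : σ m = τ.hom (∑ l, ψ.hom (lam l) * e l) :=
        sub_eq_zero.mp ((mem_nonZeroDivisors_iff_right.mp hreg) _ e1)
      rw [SetLike.mem_coe, hτw, ← e2]
      exact (hσm m).mp hm
  · -- (←)
    intro hN
    have hN1 : 𝔭.asIdeal.map ψ.hom ≤ w.asIdeal := le_trans (h𝔭 ▸ le_sup_left) hN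
    have hN2 : ∀ lam : Fin r → Γ(X, U),
        (linForm fun i => ∑ l, residue A (algebraMap Γ(X, U) A (lam l)) * residue A (a l i)) ∈
          directrixSpace (tangentConeIdeal (minGenerators A) (span_range_minGenerators A)) →
        ∑ l, ψ.hom (lam l) * e l ∈ w.asIdeal := by
      intro lam hlam
      refine hN (Ideal.mem_sup_right (Ideal.subset_span ⟨lam, hlam, rfl⟩))
    -- `w` lies over `𝔭`
    have hw𝔭 : w.asIdeal.comap ψ.hom = 𝔭.asIdeal := by
      have hle : 𝔭.asIdeal ≤ w.asIdeal.comap ψ.hom := Ideal.map_le_iff_le_comap.mp hN1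
      exact (h𝔭max.eq_of_le (Ideal.IsPrime.ne_top inferInstance) hle).symm
    have hwx : π.base (g w) = x := hover.mpr hw𝔭
    have hwU : π.base (g w) ∈ (U : X.Opens) := hwx ▸ hxU
    refine (mem_projDirectrixFibre π x _).mpr ⟨hwx, ?_⟩
    -- `φ` and the dictionary, as before
    let ι : A ≅ X.presheaf.stalk (π.base (g w)) := X.presheaf.stalkCongr (.of_eq hwx.symm)
    haveI : IsLocalHom (π.stalkMap (g w)).hom := π.toLRSHom.prop (g w)
    let φ : A →+* X'.presheaf.stalk (g w) := (π.stalkMap (g w)).hom.comp ι.hom.hom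
    have hφgerm : ∀ s : Γ(X, U), φ (algebraMap Γ(X, U) A s) =
        (π.stalkMap (g w)).hom ((X.presheaf.germ U (π.base (g w)) hwU).hom s) := by
      intro s
      rw [halg, RingHom.comp_apply]
      change (π.stalkMap (g w)).hom ((X.presheaf.germ U x hxU ≫ ι.hom).hom s) = _
      rw [TopCat.Presheaf.stalkCongr_hom, TopCat.Presheaf.germ_stalkSpecializes]
    have hφm : (maximalIdeal A).map φ ≤ maximalIdeal (X'.presheaf.stalk (g w)) := by
      rw [Ideal.map_le_iff_le_comap]
      intro m hm
      rw [Ideal.mem_comap, RingHom.comp_apply]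
      refine map_nonunit (π.stalkMap (g w)).hom _ ?_
      rw [mem_maximalIdeal, mem_nonunits_iff] at hm ⊢
      have h2 : ι.inv.hom (ι.hom.hom m) = m := by
        change (ι.hom ≫ ι.inv).hom m = m
        rw [Iso.hom_inv_id]
        rfl
      exact fun hu => hm (h2 ▸ hu.map ι.inv.hom)
    let σ : ↑(X'.presheaf.stalk (g w)) ≃+* ↑((Spec D).presheaf.stalk w) :=
      (asIso (g.stalkMap w)).commRingCatIsoToRingEquiv
    have hσ : ∀ b, σ b = (g.stalkMap w).hom b := fun _ => rfl
    let τ : D ⟶ (Spec D).presheaf.stalk w := (Scheme.ΓSpecIso D).inv ≫ (Spec D).presheaf.germ ⊤ w trivial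
    letI : Algebra D ((Spec D).presheaf.stalk w) := τ.hom.toAlgebra
    haveI hlocL : IsLocalization.AtPrime ((Spec D).presheaf.stalk w) w.asIdeal :=
      StructureSheaf.IsLocalization.to_stalk (R := D) w
    have hστ : ∀ s : Γ(X, U), σ (φ (algebraMap Γ(X, U) A s)) = τ.hom (ψ.hom s) := by
      intro s
      rw [hφgerm, hσ]
      exact stalkMap_stalkMap_germ_of_chart' π U g ψ hgπ w hwU s
    have hσm : ∀ b, b ∈ maximalIdeal (X'.presheaf.stalk (g w)) ↔ σ b ∈ maximalIdeal ((Spec D).presheaf.stalk w) := by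
      intro b
      rw [mem_maximalIdeal, mem_maximalIdeal, mem_nonunits_iff, mem_nonunits_iff, MulEquiv.isUnit_map σ]
    have hτw : ∀ d : D, d ∈ w.asIdeal ↔ τ.hom d ∈ maximalIdeal ((Spec D).presheaf.stalk w) :=
      fun d => (IsLocalization.AtPrime.to_map_mem_maximal_iff ((Spec D).presheaf.stalk w) w.asIdeal d).symm
    -- `ProjDirLiftsInto φ` from the chart condition
    refine (isOnProjDirectrix_iff_projDirLiftsInto π hwx).mpr ?_
    refine projDirLiftsInto_of_forall_symbol_mem (span_range_minGenerators A) a ha' rfl hspanA hφm fun μ => ?_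
    -- lift `μ` to sections
    have hlift := fun l => hressurj (μ l)
    choose lam hlam using hlift
    refine ⟨fun l => algebraMap Γ(X, U) A (lam l), hlam, fun hsymb => ?_⟩
    have hsymb' : (linForm fun i => ∑ l, residue A (algebraMap Γ(X, U) A (lam l)) * residue A (a l i)) ∈
        directrixSpace (tangentConeIdeal (minGenerators A) (span_range_minGenerators A)) := by
      have hfun : (fun i => ∑ l, residue A (algebraMap Γ(X, U) A (lam l)) * residue A (a l i)) =
          fun i => ∑ l, μ l * residue A (a l i) := by
        funext i
        exact Finset.sum_congr rfl fun l _ => by rw [hlam l]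
      rw [hfun]
      exact hsymb
    have hnw : ∑ l, ψ.hom (lam l) * e l ∈ w.asIdeal := hN2 lam hsymb'
    -- `φ(Σ λ_l c_l) = φ(c_j) · σ⁻¹(τ(Σ λ_l e_l))`
    have hsum : φ (∑ l, algebraMap Γ(X, U) A (lam l) * algebraMap Γ(X, U) A (c l)) =
        φ (algebraMap Γ(X, U) A (∑ l, lam l * c l)) := by
      rw [map_sum (algebraMap Γ(X, U) A)]
      congr 1
      exact Finset.sum_congr rfl fun l _ => by rw [map_mul]
    have hψsum : ψ.hom (∑ l, lam l * c l) = ψ.hom (c j) * ∑ l, ψ.hom (lam l) * e l := by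
      rw [map_sum, Finset.mul_sum]
      refine Finset.sum_congr rfl fun l _ => ?_
      rw [map_mul, hce l]
      ring
    have hdec : φ (∑ l, algebraMap Γ(X, U) A (lam l) * algebraMap Γ(X, U) A (c l)) =
        φ (algebraMap Γ(X, U) A (c j)) * σ.symm (τ.hom (∑ l, ψ.hom (lam l) * e l)) := by
      apply σ.injective
      rw [hsum, hστ, hψsum, map_mul, map_mul, hστ, σ.apply_symm_apply]
    rw [hdec]
    refine Ideal.mul_mem_mul (Ideal.mem_map_of_mem φ (hcm j)) ?_
    rw [hσm, σ.apply_symm_apply]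
    exact (hτw _).mp hnw

end Chart

/-! ## The theorem -/

set_option maxHeartbeats 800000 in
-- one long proof over large chart types (the Rees charts `chartRing c j` over `Γ(X, U)`), as in `ProjDirLine.lean`
/-- **`ℙ(Dir_x(X)) ⊂ Bℓ_x(X)` is closed** (CJS p. 103 L15 / Def. 6.34 (i): `C_1 = ℙ(Dir_x(X)) ⊂ X_1` is a closed subscheme),
for every directrix dimension `t = e_x(X)`: for a blow-up `π : X' ⟶ X` of a locally noetherian scheme `X` in a closed point
`x`, the set `projDirectrixFibre π x` is closed in `X'`. Proof: on each blow-up chart at a generator `c_j` of `𝔭_x` the set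
is the zero locus of an explicit ideal (`mem_projDirectrixFibre_chart_iff`); the charts are open embeddings covering
`π⁻¹(x) ⊇ ℙ(Dir)`. [cite: CossartJannsenSaito2020, Def. 6.34 (i), p. 103] -/
theorem isClosed_projDirectrixFibre {X X' : Scheme.{u}} [IsLocallyNoetherian X] (π : X' ⟶ X) (x : X)
    (hx : IsClosed ({x} : Set X)) (hπ : IsBlowup π (Scheme.IdealSheafData.vanishingIdeal ⟨{x}, hx⟩)) :
    IsClosed (projDirectrixFibre π x) := by
  classical
  -- (0) the centre, an affine open `U ∋ x`, `𝔭 = 𝔭_x ⊆ R = Γ(X, U)`, `𝒪_{X,x} = R_𝔭`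
  obtain ⟨U, hxU⟩ : ∃ U : X.affineOpens, x ∈ (U : X.Opens) := by
    obtain ⟨U₀, hU, hxU, -⟩ :=
      exists_isAffineOpen_mem_and_subset (X := X) (x := x) (U := ⊤) (Opens.mem_top x)
    exact ⟨⟨U₀, hU⟩, hxU⟩
  set A := X.presheaf.stalk x with hA
  obtain ⟨𝔭, h𝔭⟩ : ∃ 𝔭 : PrimeSpectrum Γ(X, U), 𝔭 = U.2.primeIdealOf ⟨x, hxU⟩ := ⟨_, rfl⟩
  haveI h𝔭max : 𝔭.asIdeal.IsMaximal := h𝔭 ▸ U.2.primeIdealOf_isMaximal_of_isClosed ⟨x, hxU⟩ hx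
  haveI : IsNoetherianRing Γ(X, U) := IsLocallyNoetherian.component_noetherian U
  letI : Algebra Γ(X, U) A := TopCat.Presheaf.algebra_section_stalk X.presheaf (⟨x, hxU⟩ : (U : X.Opens))
  haveI hloc : IsLocalization.AtPrime A 𝔭.asIdeal := h𝔭 ▸ U.2.isLocalization_stalk ⟨x, hxU⟩
  have halg : ∀ s : Γ(X, U), algebraMap Γ(X, U) A s = (X.presheaf.germ U x hxU).hom s := fun _ => rfl
  have hI : (Scheme.IdealSheafData.vanishingIdeal (⟨{x}, hx⟩ : Closeds X)).ideal U = 𝔭.asIdeal := by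
    rw [h𝔭]
    exact vanishingIdeal_singleton_ideal U.2 hx hxU
  obtain ⟨r, c, hc⟩ : ∃ (r : ℕ) (c : Fin r → Γ(X, U)), Ideal.span (Set.range c) = 𝔭.asIdeal :=
    Submodule.fg_iff_exists_fin_generating_family.mp (IsNoetherian.noetherian 𝔭.asIdeal)
  have hIc : (Scheme.IdealSheafData.vanishingIdeal (⟨{x}, hx⟩ : Closeds X)).ideal U = Ideal.span (Set.range c) :=
    hI.trans hc.symm
  -- expansions of the germs `c_l = Σ_i a_{li} x_i`
  have hcm : ∀ l, algebraMap Γ(X, U) A (c l) ∈ maximalIdeal A :=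
    fun l => (IsLocalization.AtPrime.to_map_mem_maximal_iff A 𝔭.asIdeal (c l)).mpr
      (hc ▸ Ideal.subset_span ⟨l, rfl⟩)
  have hexp : ∀ l, ∃ a : Fin (maximalIdeal A).spanFinrank → A,
      ∑ i, a i * minGenerators A i = algebraMap Γ(X, U) A (c l) :=
    fun l => Ideal.mem_span_range_iff_exists_fun.mp (by rw [span_range_minGenerators]; exact hcm l)
  choose a ha using hexp
  -- (1) the charts at the generators
  have hcharts := fun j => exists_chart_of_ideal_eq_span' hπ U c hIc j
  choose g hgopen hgπ hgmem using hcharts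
  -- (2) every point over `x` lies on some chart
  have hcover : ∀ ξ' : X', π.base ξ' = x → ∃ (j : Fin r) (w : Spec (.of (chartRing c j))), g j w = ξ' := by
    intro ξ' hξ'
    have hξU : π.base ξ' ∈ (U : X.Opens) := hξ' ▸ hxU
    obtain ⟨t, ht, hKt⟩ := hπ.isEffectiveCartier.exists_stalkIdeal_eq_span ξ'
    have hK : stalkIdeal ((Scheme.IdealSheafData.vanishingIdeal (⟨{x}, hx⟩ : Closeds X)).comap π) ξ' =
        Ideal.span (Set.range fun l => (π.stalkMap ξ').hom ((X.presheaf.germ U (π.base ξ') hξU).hom (c l))) := by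
      rw [stalkIdeal_comap_eq_map, stalkIdeal_eq_map_germ _ U hξU, hIc, Ideal.map_map, Ideal.map_span,
        ← Set.range_comp]
      rfl
    obtain ⟨j, hj⟩ := exists_span_singleton_eq_of_span_range_eq
      (fun l => (π.stalkMap ξ').hom ((X.presheaf.germ U (π.base ξ') hξU).hom (c l))) ht (hK.symm.trans hKt)
    obtain ⟨w, hw⟩ := hgmem j ξ' hξU (hKt.trans hj.symm)
    exact ⟨j, w, hw⟩
  -- (3) the chart description
  have hkey : ∀ (j : Fin r) (w : Spec (.of (chartRing c j))),
      g j w ∈ projDirectrixFibre π x ↔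
        ((U.2.primeIdealOf ⟨x, hxU⟩).asIdeal.map (CommRingCat.ofHom (chartBase c j)).hom ⊔
          Ideal.span {d : chartRing c j | ∃ lam : Fin r → Γ(X, U),
            (linForm fun i => ∑ l, residue (X.presheaf.stalk x) ((X.presheaf.germ U x hxU).hom (lam l)) *
                residue (X.presheaf.stalk x) (a l i)) ∈
              directrixSpace (canonicalTangentConeIdeal (X.presheaf.stalk x)) ∧
            d = ∑ l, (CommRingCat.ofHom (chartBase c j)).hom (lam l) * chartGen c j l}) ≤ w.asIdeal := by
    intro j w
    haveI := hgopen j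
    exact mem_projDirectrixFibre_chart_iff π U hxU (CommRingCat.ofHom (chartBase c j)) c j
      (fun l => chartGen c j l) a (g j) (hgπ j) (fun k => reesChartBase_apply_eq_mul_chartGen c j k)
      (reesChartBase_mem_nonZeroDivisors (c j) (Ideal.mem_span_range_self (f := c) (x := j))) hx
      (h𝔭 ▸ hc) ha w
  -- (4) closure argument
  refine isClosed_of_closure_subset fun ξ' hξ' => ?_
  have hsub : projDirectrixFibre π x ⊆ π.base ⁻¹' {x} := fun ξ hξ => ((mem_projDirectrixFibre π x ξ).mp hξ).1
  have hcl : closure (projDirectrixFibre π x) ⊆ π.base ⁻¹' {x} :=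
    closure_minimal hsub (hx.preimage π.base.hom.continuous)
  have hξ'x : π.base ξ' = x := hcl hξ'
  obtain ⟨j, w, hw⟩ := hcover ξ' hξ'x
  haveI := hgopen j
  have hemb : Topology.IsOpenEmbedding (g j) := (g j).isOpenEmbedding
  -- `Z = g_j⁻¹ ℙ(Dir)` is closed in the chart
  set Z : Set (Spec (.of (chartRing c j))) := (g j) ⁻¹' projDirectrixFibre π x with hZ
  obtain ⟨N, hN⟩ : ∃ N : Ideal (chartRing c j), N =
      ((U.2.primeIdealOf ⟨x, hxU⟩).asIdeal.map (CommRingCat.ofHom (chartBase c j)).hom ⊔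
          Ideal.span {d : chartRing c j | ∃ lam : Fin r → Γ(X, U),
            (linForm fun i => ∑ l, residue (X.presheaf.stalk x) ((X.presheaf.germ U x hxU).hom (lam l)) *
                residue (X.presheaf.stalk x) (a l i)) ∈
              directrixSpace (canonicalTangentConeIdeal (X.presheaf.stalk x)) ∧
            d = ∑ l, (CommRingCat.ofHom (chartBase c j)).hom (lam l) * chartGen c j l}) := ⟨_, rfl⟩
  have hZeq : Z = PrimeSpectrum.zeroLocus (N : Set (chartRing c j)) := by
    ext w'
    change g j w' ∈ projDirectrixFibre π x ↔ (N : Set (chartRing c j)) ⊆ w'.asIdeal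
    rw [hkey j w', SetLike.coe_subset_coe, hN]
  have hZcl : IsClosed Z := by
    rw [hZeq]
    exact PrimeSpectrum.isClosed_zeroLocus _
  -- `ξ' ∈ closure (ℙ(Dir) ∩ range g_j) = closure (g_j '' Z)`
  have h1 : ξ' ∈ closure (Set.range (g j) ∩ projDirectrixFibre π x) :=
    hemb.isOpen_range.inter_closure ⟨⟨w, hw⟩, hξ'⟩
  have h2 : Set.range (g j) ∩ projDirectrixFibre π x = (g j) '' Z := by
    ext ξ
    constructor
    · rintro ⟨⟨w', rfl⟩, hξ⟩
      exact ⟨w', hξ, rfl⟩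
    · rintro ⟨w', hw', rfl⟩
      exact ⟨⟨w', rfl⟩, hw'⟩
  rw [h2] at h1
  have h3 : w ∈ closure Z := by
    rw [hemb.toIsEmbedding.closure_eq_preimage_closure_image Z, Set.mem_preimage, hw]
    exact h1
  rw [hZcl.closure_eq] at h3
  rw [← hw]
  exact h3

/-- **CJS 2020, p. 103 L15 / Def. 6.34 (i), PROVED: `C_1 = ℙ(Dir_x(X)) ⊂ X_1 = Bℓ_x(X)` is closed, for every
`t = e_x(X)`** — discharges the named fact `ProjDir_isClosed` of `ProjDirProjectiveLine.lean`
(`isClosed_projDirectrixFibre`). [cite: CossartJannsenSaito2020, Def. 6.34 (i), p. 103] -/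
theorem ProjDir_isClosed_holds : ProjDir_isClosed.{u} :=
  fun _ _ _ π x hx hπ => isClosed_projDirectrixFibre π x hx hπ

end Literature.AlgebraicGeometry.CossartJannsenSaito2020

end
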